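import Literature.NumberTheory.EllipticCurves.DescendedFrobeniusMatrix
import Literature.NumberTheory.EllipticCurves.FormalGroupFrobeniusTypeProofs
import Literature.NumberTheory.EllipticCurves.FormalGroupMultiplicationUniversalProofs
import Literature.NumberTheory.EllipticCurves.FormalGroupLawAxiomsUniversalProofs
import Literature.NumberTheory.EllipticCurves.FormalGroupHasseInvariantProofs
import Summits.BirchSwinnertonDyer.BirchSwinnertonDyer.Theorems.CyclotomicUntwistNineHondaEstimate
import Summits.BirchSwinnertonDyer.BirchSwinnertonDyer.Theorems.CyclotomicUntwistDescendedFrobeniusTransferBasis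
import HarnessLib

/-!
# Honda's congruence for a good model over the RAMIFIED ring `𝓞 = 𝓞_{ℚ₃(ζ₉)}`:
# `3·(log_𝓔(z⁹) − a·log_𝓔(z³) + 3·log_𝓔(z))` has `𝓞`-integral coefficients

Cell `pub/bsd-wall`, D-0145 line `route-BirchSwinnertonDyer-CyclotomicUntwist`, lead seat `bsd-line-cycu-p1` (gen 6),
lane «HONDA OVER `𝓞_{ℚ₃(ζ₉)}`» (part 2 of 2; part 1 = `CyclotomicUntwistNineHondaEstimate`: the ramified substitution
estimate `three_mul_coeff_subst_sub_subst_mem`) — helper toward the print input `WeierstrassCurve.isDescendedFrobeniusMatrix_exists`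
of the K-SEP child C2 = stmt-BirchSwinnertonDyer-27549 (cruxes K1 `PSRankOneLowerHalfAtThree` = 21580 / K2 = 21581).

THE POINT. The tree proves the Atkin–Swinnerton-Dyer/Honda congruence `log(X^{p²}) − a·log(Xᵖ) + p·log(X) ≡ 0 (mod p)`
for a Weierstrass equation over the UNRAMIFIED ring `ℤ_p` (`FormalGroupFrobeniusTypeProofs`). The good models of the route
live over `𝓞 = integralClosure ℤ₃ ℚ₃(ζ₉)` (`WeierstrassCurve.NineGoodModel`), a totally ramified sextic ring
(`e = 6 > p − 1 = 2`: no Frobenius lift, no divided powers on the maximal ideal, outside Honda's and Fontaine's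
hypotheses). We prove the congruence THERE, for the model itself (no auxiliary `ℤ₃`-lift), with the sharp loss of
ONE factor `3`:

* (part 1) `NineHondaEstimate.three_mul_coeff_subst_sub_subst_mem` — for `ℓ ∈ ℚ₃(ζ₉)⟦X⟧` with `m·[Xᵐ]ℓ ∈ 𝓞`
  (e.g. a formal logarithm, `natCast_mul_coeff_formalLog_mem`) and `𝓞`-integral `u ≡ v (mod 1 − ζ₉)`:
  `3·(ℓ(u) − ℓ(v))` has coefficients in `𝓞`;
* `frobLHS_sub_frobRHS_eq_C_mul` — for `E/𝓞` with elliptic special fibre `Ē = E ⊗_ρ 𝔽₃` of trace `a`, the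
  Frobenius identity `F_Ē(X⁹, [3]X) = [a](X³)` of the tree (`map_toZMod_frobLHS_sub_eq_zero`, through a `ℤ₃`-lift
  of `Ē` — only the SPECIAL FIBRE is lifted) lifts to `F_E(X⁹, [3]X) ≡ [a]_E(X³) (mod (1 − ζ₉)𝓞⟦X⟧)`
  (`ker ρ = (1 − ζ₉)`, `NineIntegers.residueMap_eq_zero_iff`);
* `three_mul_coeff_honda_mem` / `hbd_honda_formalLog` — **for every `W.NineGoodModel 𝓜` and every reduction map
  `ρ`, `3·(log_𝓔(X⁹) − a·log_𝓔(X³) + 3·log_𝓔(X)) ∈ 𝓞⟦X⟧`, `a = 𝓜.specialFibreTrace ρ`, `𝓔 = 𝓜.curve`**; in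
  particular the combination `HasBoundedDenominators`;
* `hbd_honda_classOmega`, `hbd_cube_classOmega` — read on the class `[ω_W] = u⁻¹·log_𝓔` of Katz's module: with
  `φ := (z ↦ z³)^*`, `φ²[ω] ≡ a·φ[ω] − 3·[ω]` and `φ³[ω] ≡ (a² − 3)·φ[ω] − 3a·[ω]` modulo bounded denominators —
  the characteristic polynomial `X² − aX + 3` of the descended Frobenius ON THE `ω`-PLANE `⟨[ω], φ[ω]⟩`, as a
  KERNEL THEOREM (no named fact). What remains of `isDescendedFrobeniusMatrix_exists` beyond this file is the
  position of the second Néron class `[η_W]` in that plane (Katz 1981 Thm. 5.7.2 / Berthelot–Ogus (3.14)).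

THEOREMS ONLY (no `def`, no named fact, no `sorry`); BSD is not proved by this file and no crux is.

References: T. Honda, J. Math. Soc. Japan 22 (1970) §6.2 Thm. 9 [Honda1970]; N. M. Katz, LNM 868 (1981) §5.1
Key Lemma 5.1.3, Thm. 5.1.4 [Katz1981CrystallineDieudonne]; P. Berthelot, A. Ogus, Invent. Math. 72 (1983) (2.4),
(3.14) [BerthelotOgus1983]; J. H. Silverman, AEC (2009) IV.2–IV.5, V.2.3.1 [SilvermanAEC2009].
-/

-- single-conjunct summit: `Summit.BirchSwinnertonDyer.BirchSwinnertonDyer.…` repeats the name by design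
set_option linter.dupNamespace false
set_option autoImplicit false

noncomputable section

open scoped Classical
open PowerSeries IsCyclotomicExtension Literature.NumberTheory.EllipticCurves
  Literature.NumberTheory.EllipticCurves.DescendedFrobenius
  Summit.BirchSwinnertonDyer.BirchSwinnertonDyer.Theorems.NineIntegers
  Summit.BirchSwinnertonDyer.BirchSwinnertonDyer.Theorems.NineHondaEstimate
  Summit.BirchSwinnertonDyer.BirchSwinnertonDyer.Theorems.DescendedFrobeniusTransfer

namespace Summit.BirchSwinnertonDyer.BirchSwinnertonDyer.Theorems.NineHonda

/-! ### §4 The logarithm of a model over `𝓞`: integrality of `m·[Xᵐ]log`, and `log` of the Frobenius combinations -/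

section Logs

variable (E : WeierstrassCurve ONine)

/-- **`m·[Xᵐ] log_𝓔 ∈ 𝓞`** for the base change `𝓔 = E ⊗ ℚ₃(ζ₉)` of a Weierstrass equation over `𝓞`:
`[Xᵐ]log = c_{m−1}/m` with `c_{m−1}` a coefficient of the integral invariant differential `formalInvDiff`.
[cite: SilvermanAEC2009, IV.4–IV.5] -/
theorem natCast_mul_coeff_formalLog_mem (m : ℕ) :
    (m : KNine) * coeff m (E.map (algebraMap ONine KNine)).formalLog ∈ ONine := by
  set 𝓔 := E.map (algebraMap ONine KNine) with h𝓔
  rcases m with _ | _ | n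
  · simp
  · simp [WeierstrassCurve.coeff_one_formalLog]
  · have hc : coeff (n + 2) 𝓔.formalLog = algebraMap ℚ KNine (1 / (n + 2 : ℚ)) * coeff (n + 1) 𝓔.formalOmega := by
      rw [WeierstrassCurve.formalLog, coeff_mk]
    have hω : coeff (n + 1) 𝓔.formalOmega ∈ ONine := by
      rw [← WeierstrassCurve.formalInvDiff_eq_formalOmega, h𝓔, ← WeierstrassCurve.map_formalInvDiff, coeff_map]
      exact (coeff (n + 1) E.formalInvDiff).2
    have hne : ((n + 2 : ℕ) : KNine) ≠ 0 := Nat.cast_ne_zero.mpr (Nat.succ_ne_zero _)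
    have e : ((n + 2 : ℕ) : KNine) * (algebraMap ℚ KNine (1 / (n + 2 : ℚ)) * coeff (n + 1) 𝓔.formalOmega) =
        coeff (n + 1) 𝓔.formalOmega := by
      rw [← mul_assoc, map_div₀, map_one, show ((n + 2 : ℚ)) = ((n + 2 : ℕ) : ℚ) by push_cast; ring,
        map_natCast, mul_one_div_cancel hne, one_mul]
    rw [hc, e]
    exact hω

/-- `log_𝓔(F_𝓔(X⁹, [3]X)) = log_𝓔(X⁹) + 3·log_𝓔` over `ℚ₃(ζ₉)`. [cite: Honda1970, §6.2] -/
theorem formalLog_subst_frobLHS :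
    (E.map (algebraMap ONine KNine)).formalLog.subst (WeierstrassCurve.frobLHS 3 (E.map (algebraMap ONine KNine))) =
      expand (3 ^ 2) (Literature.RingTheory.FormalGroups.prime_sq_ne_zero 3)
          (E.map (algebraMap ONine KNine)).formalLog +
        3 • (E.map (algebraMap ONine KNine)).formalLog := by
  set 𝓔 := E.map (algebraMap ONine KNine) with h𝓔
  rw [WeierstrassCurve.frobLHS, 𝓔.formalLog_subst_subst_pair_formalGroupLaw
    (WeierstrassCurve.constantCoeff_X_pow' (pow_ne_zero 2 (by norm_num : (3 : ℕ) ≠ 0)))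
    (𝓔.constantCoeff_formalMul_subst_X 3), PowerSeries.expand_apply, powerSeries_subst_X_self,
    𝓔.formalLog_subst_formalMul_rat 3]

/-- `log_𝓔([m](X³)) = m·log_𝓔(X³)`. [folklore] -/
theorem formalLog_subst_frobRHSPos (m : ℕ) :
    (E.map (algebraMap ONine KNine)).formalLog.subst (WeierstrassCurve.frobRHSPos 3 (E.map (algebraMap ONine KNine)) m) =
      m • expand 3 (Literature.RingTheory.FormalGroups.prime_ne_zero 3) (E.map (algebraMap ONine KNine)).formalLog := by
  set 𝓔 := E.map (algebraMap ONine KNine) with h𝓔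
  have hXp : PowerSeries.HasSubst ((PowerSeries.X : KNine⟦X⟧) ^ 3) := PowerSeries.HasSubst.X_pow (by norm_num)
  rw [WeierstrassCurve.frobRHSPos, ← subst_comp_subst_apply (𝓔.hasSubst_formalMul m) hXp,
    𝓔.formalLog_subst_formalMul_rat m, PowerSeries.expand_apply, ← PowerSeries.coe_substAlgHom hXp, map_nsmul]

/-- `log_𝓔(i([m](X³))) = −m·log_𝓔(X³)`. [folklore] -/
theorem formalLog_subst_frobRHSNeg (m : ℕ) :
    (E.map (algebraMap ONine KNine)).formalLog.subst (WeierstrassCurve.frobRHSNeg 3 (E.map (algebraMap ONine KNine)) m) =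
      -(m • expand 3 (Literature.RingTheory.FormalGroups.prime_ne_zero 3) (E.map (algebraMap ONine KNine)).formalLog) := by
  set 𝓔 := E.map (algebraMap ONine KNine) with h𝓔
  have hP : PowerSeries.HasSubst (WeierstrassCurve.frobRHSPos 3 𝓔 m) :=
    PowerSeries.HasSubst.of_constantCoeff_zero' (𝓔.constantCoeff_frobRHSPos 3 (by norm_num) m)
  rw [WeierstrassCurve.frobRHSNeg, ← WeierstrassCurve.frobRHSPos, ← subst_comp_subst_apply
    (PowerSeries.HasSubst.of_constantCoeff_zero' 𝓔.constantCoeff_formalNeg) hP, 𝓔.formalLog_subst_formalNeg,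
    ← PowerSeries.coe_substAlgHom hP, map_neg, PowerSeries.coe_substAlgHom, formalLog_subst_frobRHSPos E m]

end Logs

/-! ### §5 The Frobenius identity of the special fibre, lifted modulo `(1 − ζ₉)` -/

/-- **The Frobenius identity over `𝔽₃`, for ANY elliptic curve `Ē/𝔽₃`**: `F_Ē(X⁹, [3]X) = [a](X³)` (resp.
`= i([|a|](X³))`), `a = 4 − #Ē(𝔽₃)` — the tree's `map_toZMod_frobLHS_sub_eq_zero` applied to a `ℤ₃`-lift of `Ē`
(every curve over `𝔽₃` lifts coefficientwise; its generic fibre is elliptic since `Δ ≢ 0`). [cite: SilvermanAEC2009, Thm. V.2.3.1(b)] -/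
theorem frobLHS_sub_frobRHS_eq_zero (Ē : WeierstrassCurve (ZMod 3)) [Ē.IsElliptic] :
    WeierstrassCurve.frobLHS 3 Ē -
      (if 0 ≤ HasseManin.tr Ē then WeierstrassCurve.frobRHSPos 3 Ē (HasseManin.tr Ē).toNat
        else WeierstrassCurve.frobRHSNeg 3 Ē (HasseManin.tr Ē).natAbs) = 0 := by
  -- a `ℤ₃`-lift of `Ē`
  obtain ⟨V, hV⟩ : ∃ V : WeierstrassCurve ℤ_[3], V.map PadicInt.toZMod = Ē :=
    ⟨⟨(Ē.a₁.val : ℤ_[3]), (Ē.a₂.val : ℤ_[3]), (Ē.a₃.val : ℤ_[3]), (Ē.a₄.val : ℤ_[3]), (Ē.a₆.val : ℤ_[3])⟩, by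
      ext <;> simp [WeierstrassCurve.map]⟩
  haveI hEt : (V.map PadicInt.toZMod).IsElliptic := by rw [hV]; infer_instance
  haveI hE : (V.map PadicInt.Coe.ringHom).IsElliptic := by
    refine ⟨?_⟩
    rw [WeierstrassCurve.map_Δ, isUnit_iff_ne_zero]
    intro h0
    have h0' : ((V.Δ : ℤ_[3]) : ℚ_[3]) = 0 := h0
    have hΔ0 : V.Δ = 0 := PadicInt.coe_eq_zero.mp h0'
    have hu : IsUnit (V.map PadicInt.toZMod).Δ := hEt.isUnit
    rw [WeierstrassCurve.map_Δ, hΔ0, map_zero] at hu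
    exact not_isUnit_zero hu
  have h := V.map_toZMod_frobLHS_sub_eq_zero (by norm_num : (3 : ℕ) ≠ 2)
  rw [map_sub, WeierstrassCurve.map_frobLHS 3 V _ (by norm_num)] at h
  simp only [hV] at h
  rw [← h]
  congr 1
  split_ifs
  · rw [WeierstrassCurve.map_frobRHSPos 3 V _ (by norm_num), hV]
  · rw [WeierstrassCurve.map_frobRHSNeg 3 V _ (by norm_num), hV]

/-- **The Frobenius identity modulo `(1 − ζ₉)` for a model over `𝓞` with elliptic special fibre**:
`F_E(X⁹, [3]X) − [a]_E(X³) ∈ (1 − ζ₉)·𝓞⟦X⟧` where `a = tr(E ⊗_ρ 𝔽₃)`. [cite: SilvermanAEC2009, Thm. V.2.3.1(b)] -/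
theorem frobLHS_sub_frobRHS_eq_C_mul (E : WeierstrassCurve ONine) (ρ : ONine →+* ZMod 3) [(E.map ρ).IsElliptic] :
    ∃ G : ONine⟦X⟧, WeierstrassCurve.frobLHS 3 E -
      (if 0 ≤ HasseManin.tr (E.map ρ) then WeierstrassCurve.frobRHSPos 3 E (HasseManin.tr (E.map ρ)).toNat
        else WeierstrassCurve.frobRHSNeg 3 E (HasseManin.tr (E.map ρ)).natAbs) =
      PowerSeries.C (⟨1 - zeta 9 ℚ_[3] KNine, one_sub_zeta_mem⟩ : ONine) * G := by
  apply exists_eq_C_varpi_mul_of_map_eq_zero ρ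
  rw [map_sub, WeierstrassCurve.map_frobLHS 3 E _ (by norm_num), ← frobLHS_sub_frobRHS_eq_zero (E.map ρ)]
  congr 1
  split_ifs
  · rw [WeierstrassCurve.map_frobRHSPos 3 E _ (by norm_num)]
  · rw [WeierstrassCurve.map_frobRHSNeg 3 E _ (by norm_num)]

/-! ### §6 Honda's congruence over `𝓞` -/

/-- **Honda's congruence for a model over `𝓞 = 𝓞_{ℚ₃(ζ₉)}` (coefficient form).** For a Weierstrass equation `E`
over `𝓞` with elliptic special fibre `E ⊗_ρ 𝔽₃` of trace `a = 4 − #(E ⊗_ρ 𝔽₃)(𝔽₃)`: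
`3·[Xⁿ](log_𝓔(X⁹) − a·log_𝓔(X³) + 3·log_𝓔(X)) ∈ 𝓞` for every `n` (`𝓔 = E ⊗ ℚ₃(ζ₉)`).
[cite: Honda1970, §6.2 Thm. 9] [cite: Katz1981CrystallineDieudonne, Key Lemma 5.1.3] -/
theorem three_mul_coeff_honda_mem_of_model (E : WeierstrassCurve ONine) (ρ : ONine →+* ZMod 3)
    [(E.map ρ).IsElliptic] (n : ℕ) :
    3 * coeff n (expand (3 ^ 2) (Literature.RingTheory.FormalGroups.prime_sq_ne_zero 3)
          (E.map (algebraMap ONine KNine)).formalLog -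
        PowerSeries.C ((HasseManin.tr (E.map ρ) : ℤ) : KNine) *
          expand 3 (Literature.RingTheory.FormalGroups.prime_ne_zero 3) (E.map (algebraMap ONine KNine)).formalLog +
        3 * (E.map (algebraMap ONine KNine)).formalLog) ∈ ONine := by
  set ι := algebraMap ONine KNine with hι
  set 𝓔 := E.map ι with h𝓔
  set a := HasseManin.tr (E.map ρ) with ha
  set RE : ONine⟦X⟧ := if 0 ≤ a then WeierstrassCurve.frobRHSPos 3 E a.toNat
    else WeierstrassCurve.frobRHSNeg 3 E a.natAbs with hRE
  obtain ⟨G, hG⟩ := frobLHS_sub_frobRHS_eq_C_mul E ρ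
  rw [← ha] at hG
  have hdvd : PowerSeries.C (⟨1 - zeta 9 ℚ_[3] KNine, one_sub_zeta_mem⟩ : ONine) ∣
      WeierstrassCurve.frobLHS 3 E - RE := ⟨G, hG⟩
  have hU0 : constantCoeff (WeierstrassCurve.frobLHS 3 E) = 0 := E.constantCoeff_frobLHS 3 (by norm_num)
  have hV0 : constantCoeff RE = 0 := by
    rw [hRE]; split_ifs
    · exact E.constantCoeff_frobRHSPos 3 (by norm_num) _
    · exact E.constantCoeff_frobRHSNeg 3 (by norm_num) _
  have key := three_mul_coeff_subst_sub_subst_mem (natCast_mul_coeff_formalLog_mem E) hU0 hV0 hdvd n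
  -- identify the two logarithms
  have hu : (WeierstrassCurve.frobLHS 3 E).map ι = WeierstrassCurve.frobLHS 3 𝓔 :=
    WeierstrassCurve.map_frobLHS 3 E _ (by norm_num)
  have hlog : 𝓔.formalLog.subst ((WeierstrassCurve.frobLHS 3 E).map ι) - 𝓔.formalLog.subst (RE.map ι) =
      expand (3 ^ 2) (Literature.RingTheory.FormalGroups.prime_sq_ne_zero 3) 𝓔.formalLog -
        PowerSeries.C ((a : ℤ) : KNine) * expand 3 (Literature.RingTheory.FormalGroups.prime_ne_zero 3) 𝓔.formalLog +
        3 * 𝓔.formalLog := by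
    rw [hu, formalLog_subst_frobLHS E, hRE]
    split_ifs with hpos
    · rw [WeierstrassCurve.map_frobRHSPos 3 E _ (by norm_num), ← h𝓔, formalLog_subst_frobRHSPos E,
        nsmul_eq_mul, nsmul_eq_mul, show ((a.toNat : ℕ) : KNine⟦X⟧) = PowerSeries.C ((a : ℤ) : KNine) by
          rw [← map_natCast (PowerSeries.C (R := KNine)), ← Int.cast_natCast, Int.toNat_of_nonneg hpos],
        show ((3 : ℕ) : KNine⟦X⟧) = 3 from rfl]
      ring
    · rw [WeierstrassCurve.map_frobRHSNeg 3 E _ (by norm_num), ← h𝓔, formalLog_subst_frobRHSNeg E,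
        nsmul_eq_mul, nsmul_eq_mul, show ((a.natAbs : ℕ) : KNine⟦X⟧) = -PowerSeries.C ((a : ℤ) : KNine) by
          rw [← map_natCast (PowerSeries.C (R := KNine)), ← map_neg, ← Int.cast_natCast, ← Int.cast_neg]
          congr 2
          omega,
        show ((3 : ℕ) : KNine⟦X⟧) = 3 from rfl]
      ring
  rw [← hlog]
  exact key

/-- `HasseManin.tr` of the special fibre is the model's `specialFibreTrace` (`#𝔽₃ + 1 = 4`). [folklore] -/
theorem tr_specialFibre_eq {W : WeierstrassCurve ℚ} (𝓜 : W.NineGoodModel) (ρ : ONine →+* ZMod 3) :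
    HasseManin.tr (𝓜.E.map ρ) = 𝓜.specialFibreTrace ρ := by
  rw [HasseManin.tr, WeierstrassCurve.NineGoodModel.specialFibreTrace, WeierstrassCurve.NineGoodModel.specialFibre,
    ZMod.card]
  norm_num

/-- The special fibre of a good model is an elliptic curve over `𝔽₃` (unit discriminant). [cite: SilvermanAEC2009, VII.1] -/
theorem isElliptic_specialFibre {W : WeierstrassCurve ℚ} (𝓜 : W.NineGoodModel) (ρ : ONine →+* ZMod 3) :
    (𝓜.E.map ρ).IsElliptic :=
  ⟨by rw [WeierstrassCurve.map_Δ]; exact 𝓜.isUnit_Δ.map ρ⟩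

/-- **HONDA'S CONGRUENCE OVER `𝓞_{ℚ₃(ζ₉)}` for a good model of `W/ℚ`.** For every `𝓜 : W.NineGoodModel` and every
reduction map `ρ`, with `a = 𝓜.specialFibreTrace ρ` and `𝓔 = 𝓜.curve`:
`3·[Xⁿ](log_𝓔(X⁹) − a·log_𝓔(X³) + 3·log_𝓔(X)) ∈ 𝓞` for every `n`. [cite: Honda1970, §6.2 Thm. 9]
[cite: Katz1981CrystallineDieudonne, Key Lemma 5.1.3 and Thm. 5.1.4] -/
theorem three_mul_coeff_honda_mem {W : WeierstrassCurve ℚ} (𝓜 : W.NineGoodModel) (ρ : ONine →+* ZMod 3) (n : ℕ) :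
    3 * coeff n (expand (3 ^ 2) (Literature.RingTheory.FormalGroups.prime_sq_ne_zero 3) 𝓜.curve.formalLog -
        PowerSeries.C ((𝓜.specialFibreTrace ρ : ℤ) : KNine) *
          expand 3 (Literature.RingTheory.FormalGroups.prime_ne_zero 3) 𝓜.curve.formalLog +
        3 * 𝓜.curve.formalLog) ∈ ONine := by
  haveI := isElliptic_specialFibre 𝓜 ρ
  rw [← tr_specialFibre_eq 𝓜 ρ]
  exact three_mul_coeff_honda_mem_of_model 𝓜.E ρ n

/-- **Honda's relation has bounded denominators** (denominator `3¹`): `log_𝓔(X⁹) − a·log_𝓔(X³) + 3·log_𝓔 ∈ 𝓞⟦X⟧ ⊗ ℚ`.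
[cite: Honda1970, §6.2 Thm. 9] [cite: Katz1981CrystallineDieudonne, Thm. 5.1.4] -/
theorem hbd_honda_formalLog {W : WeierstrassCurve ℚ} (𝓜 : W.NineGoodModel) (ρ : ONine →+* ZMod 3) :
    HasBoundedDenominators (expand (3 ^ 2) (Literature.RingTheory.FormalGroups.prime_sq_ne_zero 3) 𝓜.curve.formalLog -
        PowerSeries.C ((𝓜.specialFibreTrace ρ : ℤ) : KNine) *
          expand 3 (Literature.RingTheory.FormalGroups.prime_ne_zero 3) 𝓜.curve.formalLog +
        3 * 𝓜.curve.formalLog) := by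
  refine ⟨1, fun n => ?_⟩
  rw [pow_one]
  exact three_mul_coeff_honda_mem 𝓜 ρ n

/-! ### §7 On the class `[ω_W]`: the characteristic polynomial of Frobenius on the `ω`-plane -/

/-- **Honda's relation on the Néron class `[ω_W] = u⁻¹·log_𝓔`**: for every good model 𝓜 of `W` and every `ρ`,
`classOmega(X⁹) − a·classOmega(X³) + 3·classOmega` has bounded denominators (`a = 𝓜.specialFibreTrace ρ`) — i.e.
with `φ = (z ↦ z³)^*` on `ℚ₃(ζ₉)⟦z⟧/(bounded denominators)`: `(φ² − aφ + 3)[ω_W] = 0`.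
[cite: Katz1981CrystallineDieudonne, Thm. 5.1.4 and (6.1.1)] [cite: BerthelotOgus1983, Prop. (3.14)] -/
theorem hbd_honda_classOmega {W : WeierstrassCurve ℚ} (𝓜 : W.NineGoodModel) (ρ : ONine →+* ZMod 3) :
    HasBoundedDenominators (expand (3 ^ 2) (Literature.RingTheory.FormalGroups.prime_sq_ne_zero 3) 𝓜.classOmega -
        PowerSeries.C ((𝓜.specialFibreTrace ρ : ℤ) : KNine) *
          expand 3 (Literature.RingTheory.FormalGroups.prime_ne_zero 3) 𝓜.classOmega +
        3 * 𝓜.classOmega) := by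
  have h := hbd_C_mul ((𝓜.C.u⁻¹ : KNineˣ) : KNine) (hbd_honda_formalLog 𝓜 ρ)
  have e : PowerSeries.C ((𝓜.C.u⁻¹ : KNineˣ) : KNine) *
      (expand (3 ^ 2) (Literature.RingTheory.FormalGroups.prime_sq_ne_zero 3) 𝓜.curve.formalLog -
        PowerSeries.C ((𝓜.specialFibreTrace ρ : ℤ) : KNine) *
          expand 3 (Literature.RingTheory.FormalGroups.prime_ne_zero 3) 𝓜.curve.formalLog +
        3 * 𝓜.curve.formalLog) =
      expand (3 ^ 2) (Literature.RingTheory.FormalGroups.prime_sq_ne_zero 3) 𝓜.classOmega -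
        PowerSeries.C ((𝓜.specialFibreTrace ρ : ℤ) : KNine) *
          expand 3 (Literature.RingTheory.FormalGroups.prime_ne_zero 3) 𝓜.classOmega +
        3 * 𝓜.classOmega := by
    rw [WeierstrassCurve.NineGoodModel.classOmega, smul_eq_C_mul, map_mul, map_mul, expand_C, expand_C]
    ring
  rwa [e] at h

/-- **The cube relation on the `ω`-plane**: `classOmega(X²⁷) ≡ (a² − 3)·classOmega(X³) − 3a·classOmega` modulo
bounded denominators — `φ³ = (a² − 3)φ − 3a` on `⟨[ω], φ[ω]⟩`, the companion matrix `!![0, −3; 1, a]` cubed; with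
`hbd_honda_classOmega` (`φ² = aφ − 3`) these are the `ω`-rows of `IsPowerMapMatrix 𝓜 9 (M²)` / `… 27 (M³)` read in
the basis `([ω], φ[ω])`. [cite: Katz1981CrystallineDieudonne, Thm. 5.1.4] [cite: BerthelotOgus1983, Prop. (3.14)] -/
theorem hbd_cube_classOmega {W : WeierstrassCurve ℚ} (𝓜 : W.NineGoodModel) (ρ : ONine →+* ZMod 3) :
    HasBoundedDenominators (expand (3 ^ 3) (pow_ne_zero 3 (by norm_num)) 𝓜.classOmega -
        PowerSeries.C (((𝓜.specialFibreTrace ρ : ℤ) : KNine) ^ 2 - 3) *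
          expand 3 (Literature.RingTheory.FormalGroups.prime_ne_zero 3) 𝓜.classOmega +
        PowerSeries.C (3 * ((𝓜.specialFibreTrace ρ : ℤ) : KNine)) * 𝓜.classOmega) := by
  set a : KNine := ((𝓜.specialFibreTrace ρ : ℤ) : KNine) with ha
  set Ω := 𝓜.classOmega with hΩ
  have R := hbd_honda_classOmega 𝓜 ρ
  rw [← ha, ← hΩ] at R
  -- apply `expand 3` to the Honda relation
  have R3 := hbd_expand 3 (Literature.RingTheory.FormalGroups.prime_ne_zero 3) R
  rw [map_add, map_sub, map_mul, map_mul, expand_C,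
    expand_expand
      (Literature.RingTheory.FormalGroups.prime_ne_zero 3) (Literature.RingTheory.FormalGroups.prime_sq_ne_zero 3)
      (pow_ne_zero 3 (by norm_num : (3 : ℕ) ≠ 0)) (by norm_num) Ω,
    expand_expand
      (Literature.RingTheory.FormalGroups.prime_ne_zero 3) (Literature.RingTheory.FormalGroups.prime_ne_zero 3)
      (Literature.RingTheory.FormalGroups.prime_sq_ne_zero 3) (by norm_num) Ω,
    show expand 3 (Literature.RingTheory.FormalGroups.prime_ne_zero 3) (3 : KNine⟦X⟧) = 3 from map_ofNat _ 3] at R3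
  -- `R3 : HBD (Ω(X²⁷) − a Ω(X⁹) + 3 Ω(X³))`; combine with `a · R`
  have RA := hbd_C_mul a R
  have hsum := R3.add RA
  have e : expand (3 ^ 3) (pow_ne_zero 3 (by norm_num)) Ω -
        PowerSeries.C a * expand (3 ^ 2) (Literature.RingTheory.FormalGroups.prime_sq_ne_zero 3) Ω +
        3 * expand 3 (Literature.RingTheory.FormalGroups.prime_ne_zero 3) Ω +
      PowerSeries.C a * (expand (3 ^ 2) (Literature.RingTheory.FormalGroups.prime_sq_ne_zero 3) Ω -
        PowerSeries.C a * expand 3 (Literature.RingTheory.FormalGroups.prime_ne_zero 3) Ω + 3 * Ω) =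
      expand (3 ^ 3) (pow_ne_zero 3 (by norm_num)) Ω - PowerSeries.C (a ^ 2 - 3) *
        expand 3 (Literature.RingTheory.FormalGroups.prime_ne_zero 3) Ω + PowerSeries.C (3 * a) * Ω := by
    simp only [map_sub, map_pow, map_mul, map_ofNat]
    ring
  rwa [e] at hsum

end Summit.BirchSwinnertonDyer.BirchSwinnertonDyer.Theorems.NineHonda

end
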